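import Summits.Ventures.PackingBounds.Configurations.CohnLiCount
import Summits.Ventures.PackingBounds.Configurations.Leech
import Summits.Ventures.PackingBounds.Configurations.SubspaceTransfer
import Summits.Ventures.PackingBounds.Kissing.DimensionNineteen
import Summits.Ventures.PackingBounds.Kissing.DimensionTwenty
import Summits.Ventures.PackingBounds.Kissing.DimensionTwentyOne

/-!
# Cohn–Li kissing configurations (2024), III: `κ(19) ≥ 11692`, `κ(20) ≥ 19448`, `κ(21) ≥ 29768` in Lean

Framing: lottery ticket; floor = certified bounds/negative ranges. Venture `PackingBounds` (cell
`pub-packcert`, seat `pub-packcert-energy`).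

The Cohn–Li configuration for `(n, Z)` is `clInt n / √32 ∪ setS n Z / √n ⊂ ℝ²⁴` (`CohnLiCount.lean`):
unit vectors, supported on the coordinates `< n`, with pairwise inner products `≤ 16/32`, `≤ 12/√(32 n)`
(`≤ 1/2` as soon as `n ≥ 18`) and `≤ (n/2)/n`. Transferring to the coordinate subspace `ℝⁿ`
(`Config.exists_transfer_orthogonal` with the `24 - n` coordinate vectors as normals) gives kissing
configurations of `29768`, `19448`, `11692` unit vectors in `ℝ²¹, ℝ²⁰, ℝ¹⁹`: **the kissing numbers in
dimensions `21, 20, 19` are at least `29768, 19448, 11692`** (Cohn–Li 2024, Theorem 1.1; records for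
`d = 20, 21` at the time of writing, `d = 19` since improved to `11948`, arXiv:2603.10425), here as
kernel-checked theorems (`exists_kissing_29768`, `exists_kissing_19448`, `exists_kissing_11692`); with the cell's
Delsarte LP certificates: `29768 ≤ κ(21) ≤ 56851`, `19448 ≤ κ(20) ≤ 37974`, `11692 ≤ κ(19) ≤ 25900`.

## References
* H. Cohn, A. Li, *Improved kissing numbers in seventeen through twenty-one dimensions*, arXiv:2411.04916 (2024), Thm. 1.1, §2.
* J. H. Conway, N. J. A. Sloane, *Sphere Packings, Lattices and Groups*, Ch. 1 Table 1.2. [`ConwaySloane1999`]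
-/

namespace Summit.Ventures.PackingBounds.Config.Leech

open Finset Golay

local notation "E24" => EuclideanSpace ℝ (Fin 24)

/-! ### Mixed scalings -/

/-- `⟪x/√q, y/√q'⟫ = ip x y / (√q √q')`. -/
theorem inner_toE_toE {q q' : ℝ} (hq : 0 < q) (hq' : 0 < q') (x y : Fin 24 → ℤ) :
    inner ℝ (toE q x) (toE q' y) = (ip x y : ℝ) / (Real.sqrt q * Real.sqrt q') := by
  rw [toE, toE, EuclideanSpace.inner_toLp_toLp, dotProduct]
  simp only [star_trivial, ip, Int.cast_sum, Int.cast_mul]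
  rw [Finset.sum_div]
  refine Finset.sum_congr rfl fun j _ => ?_
  have h1 : Real.sqrt q ≠ 0 := Real.sqrt_ne_zero'.mpr hq
  have h2 : Real.sqrt q' ≠ 0 := Real.sqrt_ne_zero'.mpr hq'
  field_simp

/-- The coordinates of `toE q x`. -/
theorem toE_apply (q : ℝ) (x : Fin 24 → ℤ) (j : Fin 24) : toE q x j = (Real.sqrt q)⁻¹ * (x j : ℝ) := by
  simp [toE]

/-! ### The configuration in `ℝ²⁴` -/

/-- The Cohn–Li configuration for `n` kept coordinates and shortened coordinates `Z`, inside `ℝ²⁴`. -/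
noncomputable def clConf (n : ℕ) (Z : List ℕ) : Finset E24 :=
  (clInt n).image (toE 32) ∪ (setS n Z).image (toE n)

/-- The two scaled parts are disjoint (`x₀/√32 = ±1/√n` forces `n ∈ {2, 8}`). -/
theorem disjoint_clConf {n : ℕ} (hn18 : 18 ≤ n) (hn : n ≤ 24) (Z : List ℕ) :
    Disjoint ((clInt n).image (toE 32)) ((setS n Z).image (toE (n : ℝ))) := by
  rw [Finset.disjoint_left]
  intro p hp hq
  obtain ⟨x, hx, rfl⟩ := mem_image.mp hp
  obtain ⟨s, hs, he⟩ := mem_image.mp hq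
  have h0 : (0 : Fin 24).val < n := by simp; omega
  have e0 := congrArg (fun v : E24 => v 0) he
  simp only [toE_apply] at e0
  have hs0 := apply_cases_of_mem_setS hs h0
  have hx0 := apply_cases_of_mem_clInt hx 0
  have hsq : (Real.sqrt (n : ℝ))⁻¹ ^ 2 * (s 0 : ℝ) ^ 2 = (Real.sqrt 32)⁻¹ ^ 2 * (x 0 : ℝ) ^ 2 := by
    have := congrArg (fun t : ℝ => t ^ 2) e0; simpa [mul_pow] using this
  rw [inv_pow, inv_pow, Real.sq_sqrt (by positivity), Real.sq_sqrt (by norm_num)] at hsq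
  have hs1 : (s 0 : ℝ) ^ 2 = 1 := by rcases hs0 with h | h <;> rw [h] <;> norm_num
  rw [hs1, mul_one] at hsq
  have hnpos : (0 : ℝ) < n := by exact_mod_cast (show 0 < n by omega)
  -- `x 0 ^ 2 * n = 32`
  have key : (x 0 : ℝ) ^ 2 * n = 32 := by
    field_simp at hsq
    linarith
  have key' : (x 0) ^ 2 * (n : ℤ) = 32 := by exact_mod_cast key
  rcases hx0 with h | h | h | h | h <;> rw [h] at key' <;> omega

/-- **`|clConf n Z| = |clInt n| + |setS n Z|`.** -/
theorem card_clConf {n : ℕ} (hn18 : 18 ≤ n) (hn : n ≤ 24) (Z : List ℕ) :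
    (clConf n Z).card = (clInt n).card + (setS n Z).card := by
  have hnpos : (0 : ℝ) < n := by exact_mod_cast (show 0 < n by omega)
  rw [clConf, card_union_eq_card_add_card.mpr (disjoint_clConf hn18 hn Z),
    card_image_of_injective _ (toE_injective (by norm_num)), card_image_of_injective _ (toE_injective hnpos)]

/-- All vectors of the Cohn–Li configuration are unit vectors. -/
theorem norm_clConf {n : ℕ} (hn18 : 18 ≤ n) (hn : n ≤ 24) (Z : List ℕ) : ∀ p ∈ clConf n Z, ‖p‖ = 1 := by
  intro p hp
  rw [clConf, mem_union] at hp
  rcases hp with hp | hp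
  · obtain ⟨x, hx, rfl⟩ := mem_image.mp hp
    exact norm_toE (by norm_num) (by rw [ip_self_of_mem_clInt hx]; norm_num)
  · obtain ⟨s, hs, rfl⟩ := mem_image.mp hp
    exact norm_toE (by exact_mod_cast (show 0 < n by omega)) (by rw [ip_self_of_mem_setS hn hs]; simp)

/-- `12 / √(32 n) ≤ 1/2` for `n ≥ 18`. -/
theorem twelve_div_le {n : ℕ} (hn18 : 18 ≤ n) {t : ℝ} (ht : t ≤ 12) :
    t / (Real.sqrt 32 * Real.sqrt n) ≤ 1 / 2 := by
  have hnpos : (0 : ℝ) < n := by exact_mod_cast (show 0 < n by omega)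
  have hprod : Real.sqrt 32 * Real.sqrt n = Real.sqrt (32 * n) := (Real.sqrt_mul (by norm_num) _).symm
  have h18 : (18 : ℝ) ≤ n := by exact_mod_cast hn18
  have h576 : (24 : ℝ) ^ 2 ≤ 32 * n := by nlinarith
  have h24 : (24 : ℝ) ≤ Real.sqrt (32 * n) := by
    rw [show (24 : ℝ) = Real.sqrt (24 ^ 2) by rw [Real.sqrt_sq (by norm_num)]]
    exact Real.sqrt_le_sqrt h576
  rw [hprod, div_le_iff₀ (by positivity)]
  linarith

/-- **Pairwise inner products `≤ 1/2`** in the Cohn–Li configuration (`18 ≤ n ≤ 24`, `n + 4p ≤ 32`). -/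
theorem inner_clConf {n : ℕ} (hn18 : 18 ≤ n) (hn : n ≤ 24) {Z : List ℕ} {p : ℕ}
    (hp : (univ.filter fun j : Fin 24 => ¬ j.val < n ∧ j.val ∉ Z).card = p) (hnp : n + 4 * p ≤ 32) :
    ∀ a ∈ clConf n Z, ∀ b ∈ clConf n Z, a ≠ b → inner ℝ a b ≤ 1 / 2 := by
  have hnpos : (0 : ℝ) < n := by exact_mod_cast (show 0 < n by omega)
  intro a ha b hb hab
  rw [clConf, mem_union] at ha hb
  rcases ha with ha | ha <;> rcases hb with hb | hb
  · obtain ⟨x, hx, rfl⟩ := mem_image.mp ha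
    obtain ⟨y, hy, rfl⟩ := mem_image.mp hb
    have hxy : x ≠ y := fun h => hab (by rw [h])
    rw [inner_toE (by norm_num), div_le_iff₀ (by norm_num)]
    have := ip_le_of_mem_clInt hx hy hxy
    have : (ip x y : ℝ) ≤ 16 := by exact_mod_cast this
    linarith
  · obtain ⟨x, hx, rfl⟩ := mem_image.mp ha
    obtain ⟨s, hs, rfl⟩ := mem_image.mp hb
    rw [inner_toE_toE (by norm_num) hnpos]
    exact twelve_div_le hn18 (by exact_mod_cast ip_le_of_mem_clInt_setS hx hs)
  · obtain ⟨s, hs, rfl⟩ := mem_image.mp ha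
    obtain ⟨x, hx, rfl⟩ := mem_image.mp hb
    rw [inner_toE_toE hnpos (by norm_num), mul_comm, ip_comm]
    exact twelve_div_le hn18 (by exact_mod_cast ip_le_of_mem_clInt_setS hx hs)
  · obtain ⟨s, hs, rfl⟩ := mem_image.mp ha
    obtain ⟨s', hs', rfl⟩ := mem_image.mp hb
    have hss : s ≠ s' := fun h => hab (by rw [h])
    rw [inner_toE hnpos, div_le_iff₀ hnpos]
    have := two_ip_le_of_mem_setS hn hp hnp hs hs' hss
    have : (2 : ℝ) * (ip s s' : ℝ) ≤ n := by exact_mod_cast this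
    linarith

/-- The configuration is orthogonal to the coordinate vectors `e_j`, `j ≥ n`. -/
theorem inner_single_clConf {n : ℕ} (Z : List ℕ) {j : Fin 24} (hj : ¬ j.val < n) :
    ∀ p ∈ clConf n Z, inner ℝ (EuclideanSpace.single j (1 : ℝ)) p = 0 := by
  intro p hp
  rw [EuclideanSpace.inner_single_left, map_one, one_mul]
  rw [clConf, mem_union] at hp
  rcases hp with hp | hp
  · obtain ⟨x, hx, rfl⟩ := mem_image.mp hp
    rw [toE_apply, apply_eq_zero_of_mem_clInt hx hj]; simp
  · obtain ⟨s, hs, rfl⟩ := mem_image.mp hp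
    rw [toE_apply, apply_eq_zero_of_mem_setS hs hj]; simp

/-- The coordinate vectors `e_{n}, …, e_{23}` as a linearly independent family. -/
theorem linearIndependent_tail (n k : ℕ) (hk : n + k = 24) :
    LinearIndependent ℝ (fun i : Fin k => EuclideanSpace.single (⟨n + i.val, by omega⟩ : Fin 24) (1 : ℝ)) := by
  have ho := EuclideanSpace.orthonormal_single (𝕜 := ℝ) (ι := Fin 24)
  have hf : Function.Injective (fun i : Fin k => (⟨n + i.val, by omega⟩ : Fin 24)) := by
    intro i i' h
    have := congrArg Fin.val h
    simp only at this
    exact Fin.ext (by omega)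
  exact (ho.comp _ hf).linearIndependent

/-- **Transfer to `ℝⁿ`**: a kissing configuration of `|clInt n| + |setS n Z|` unit vectors in `ℝⁿ`. -/
theorem exists_kissing_cohnLi {n : ℕ} (hn18 : 18 ≤ n) (hn : n ≤ 24) {Z : List ℕ} {p : ℕ}
    (hp : (univ.filter fun j : Fin 24 => ¬ j.val < n ∧ j.val ∉ Z).card = p) (hnp : n + 4 * p ≤ 32) :
    ∃ C : Finset (EuclideanSpace ℝ (Fin n)), C.card = (clInt n).card + (setS n Z).card ∧
      (∀ x ∈ C, ‖x‖ = 1) ∧ (∀ x ∈ C, ∀ y ∈ C, x ≠ y → inner ℝ x y ≤ 1 / 2) := by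
  obtain ⟨C', hc, hno, hi, _⟩ := exists_transfer_orthogonal (m := 24) (n := n) (k := 24 - n) (by omega)
    (fun i : Fin (24 - n) => EuclideanSpace.single (⟨n + i.val, by omega⟩ : Fin 24) (1 : ℝ))
    (linearIndependent_tail n (24 - n) (by omega)) (clConf n Z)
    (fun x hx i => inner_single_clConf Z (by simp) x hx)
  refine ⟨C', by rw [hc, card_clConf hn18 hn], fun x' hx' => ?_, fun x' hx' y' hy' hne => ?_⟩
  · obtain ⟨x, hx, he⟩ := hno x' hx'
    rw [he]; exact norm_clConf hn18 hn Z x hx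
  · obtain ⟨x, hx, y, hy, hxy, he⟩ := hi x' hx' y' hy' hne
    rw [he]; exact inner_clConf hn18 hn hp hnp x hx y hy hxy

/-! ### The three theorems -/

/-- **`κ(21) ≥ 29768`** (Cohn–Li 2024, Theorem 1.1): a kissing configuration of `29768` unit vectors in `ℝ²¹`. -/
theorem exists_kissing_29768 : ∃ C : Finset (EuclideanSpace ℝ (Fin 21)),
    C.card = 29768 ∧ (∀ x ∈ C, ‖x‖ = 1) ∧ (∀ x ∈ C, ∀ y ∈ C, x ≠ y → inner ℝ x y ≤ 1 / 2) := by
  obtain ⟨C, hc, h1, h2⟩ := exists_kissing_cohnLi (n := 21) (by norm_num) (by norm_num) (Z := [21]) (p := 2)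
    (by decide) (by norm_num)
  exact ⟨C, by rw [hc, card_cohnLi.1], h1, h2⟩

/-- **`κ(20) ≥ 19448`** (Cohn–Li 2024, Theorem 1.1): a kissing configuration of `19448` unit vectors in `ℝ²⁰`. -/
theorem exists_kissing_19448 : ∃ C : Finset (EuclideanSpace ℝ (Fin 20)),
    C.card = 19448 ∧ (∀ x ∈ C, ‖x‖ = 1) ∧ (∀ x ∈ C, ∀ y ∈ C, x ≠ y → inner ℝ x y ≤ 1 / 2) := by
  obtain ⟨C, hc, h1, h2⟩ := exists_kissing_cohnLi (n := 20) (by norm_num) (by norm_num) (Z := [21]) (p := 3)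
    (by decide) (by norm_num)
  exact ⟨C, by rw [hc, card_cohnLi.2.1], h1, h2⟩

/-- **`κ(19) ≥ 11692`** (Cohn–Li 2024, Theorem 1.1): a kissing configuration of `11692` unit vectors in `ℝ¹⁹`. -/
theorem exists_kissing_11692 : ∃ C : Finset (EuclideanSpace ℝ (Fin 19)),
    C.card = 11692 ∧ (∀ x ∈ C, ‖x‖ = 1) ∧ (∀ x ∈ C, ∀ y ∈ C, x ≠ y → inner ℝ x y ≤ 1 / 2) := by
  obtain ⟨C, hc, h1, h2⟩ := exists_kissing_cohnLi (n := 19) (by norm_num) (by norm_num) (Z := [19, 21]) (p := 3)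
    (by decide) (by norm_num)
  exact ⟨C, by rw [hc, card_cohnLi.2.2], h1, h2⟩

/-- **`29768 ≤ κ(21) ≤ 56851` in Lean.** -/
theorem kissing_dim21_cohnLi_bracket :
    (∃ C : Finset (EuclideanSpace ℝ (Fin 21)), C.card = 29768 ∧ (∀ x ∈ C, ‖x‖ = 1) ∧
      (∀ x ∈ C, ∀ y ∈ C, x ≠ y → inner ℝ x y ≤ 1 / 2)) ∧
    ∀ C : Finset (EuclideanSpace ℝ (Fin 21)), (∀ x ∈ C, ‖x‖ = 1) →
      (∀ x ∈ C, ∀ y ∈ C, x ≠ y → inner ℝ x y ≤ 1 / 2) → C.card ≤ 56851 :=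
  ⟨exists_kissing_29768, Kissing.kissing_dim21_le_56851⟩

/-- **`19448 ≤ κ(20) ≤ 37974` in Lean.** -/
theorem kissing_dim20_cohnLi_bracket :
    (∃ C : Finset (EuclideanSpace ℝ (Fin 20)), C.card = 19448 ∧ (∀ x ∈ C, ‖x‖ = 1) ∧
      (∀ x ∈ C, ∀ y ∈ C, x ≠ y → inner ℝ x y ≤ 1 / 2)) ∧
    ∀ C : Finset (EuclideanSpace ℝ (Fin 20)), (∀ x ∈ C, ‖x‖ = 1) →
      (∀ x ∈ C, ∀ y ∈ C, x ≠ y → inner ℝ x y ≤ 1 / 2) → C.card ≤ 37974 :=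
  ⟨exists_kissing_19448, Kissing.kissing_dim20_le_37974⟩

/-- **`11692 ≤ κ(19) ≤ 25900` in Lean.** -/
theorem kissing_dim19_cohnLi_bracket :
    (∃ C : Finset (EuclideanSpace ℝ (Fin 19)), C.card = 11692 ∧ (∀ x ∈ C, ‖x‖ = 1) ∧
      (∀ x ∈ C, ∀ y ∈ C, x ≠ y → inner ℝ x y ≤ 1 / 2)) ∧
    ∀ C : Finset (EuclideanSpace ℝ (Fin 19)), (∀ x ∈ C, ‖x‖ = 1) →
      (∀ x ∈ C, ∀ y ∈ C, x ≠ y → inner ℝ x y ≤ 1 / 2) → C.card ≤ 25900 :=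
  ⟨exists_kissing_11692, Kissing.kissing_dim19_le_25900⟩

end Summit.Ventures.PackingBounds.Config.Leech
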